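import Summits.QuantumFields.BalabanUV.Beta.D1BFx.TwoPointLegPieces
import Summits.QuantumFields.BalabanUV.Beta.D1BFx.TwoPointPairs
import Summits.QuantumFields.BalabanUV.Beta.D1BFx.GradedBiBubbleMoving

/-!
# `BalabanUV.Beta.D1BFx.TwoPointBubbles` — road «BF-x» for binder row D1, «A3.c ∕ L-X TAILS» PART II (I3b): ONE elementary two-point term through two
# leg pieces `legPiece r`, `legPiece r'` (`(r, r') ≠ (0, 0)`) under the moment weight — summable, `|fullSum| ≤ Bnd` with `Bnd` fixed before the scale

HONEST DEPENDENCY (page 1, mandatory): continuum YM on T⁴ ⇐ BetaPertH ∧ nine spine estimates (0/9 proved); BetaPertH ⇐ (D1) ∧ (D4) ∧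
CAP+tail; G-an2-4 gates asym, D1 and NE2/3/4.  HONEST FRAMING (cell contract, verbatim): «discharging `BetaPertH` makes Bałaban's UV
stability UNCONDITIONAL — a real constructive-QFT result; it is NOT the continuum limit and NOT the Clay problem.»  THIS MODULE DISCHARGES
NOTHING of the wall: [folklore] composition BY NAME of part (I2) `TwoPointLegPieces` (the leg pieces' rows), part (I3a) `TwoPointPairs` (pair bounds),
part (F1) `TwoPointEnds`, part (C2) `ScaleLegTermBound.exists_soft_iterD_free`.  The entry rows of `K^∞` and the rows of the profile `g` are
HYPOTHESES in the END's shape (discharged in part (J) from the printed `h12`∕`h126`); no `def`, no `Prop` minted, nothing cited anew, 0 sorry.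
0 wall binders; NOT an A3.c row, NOT (K), NOT D1, NOT `BetaPertH`, NOT continuum, NOT Clay.

ABSOLUTE RULE (cell charter, verbatim): «No internally-minted statement may enter as a cited fact. Every hypothesis is either kernel-proved in
this package or a verbatim quotation of a PUBLISHED theorem with page reference. The manuscript(s) under audit are NOT citable for their own
disputed steps — they are the thing under adjudication; programme-internal (2001/route/tribunal) claims are never citable.»

WHY (this lineage's N-d1leaf03g12-2): with the first vertex at `b + w` and the second at `b`, an elementary term of part (F3) reads
`c·Λ_A(w + x_A)·Λ_B(w + x_B)` with BOTH legs in the normal form `Λ(u) = itL sL (itR sR P) x₀ (x₀ + u)` (`P` a fibre entry of a leg piece; for the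
second leg after the transpose law, its moving end being its first argument); part (I2) packages every such `Λ` (far exponent `2 + min k 1`, flat
grade `n^{−(2+min k 1)}`, free part only for the frozen piece's diagonal entries); part (I3a) bounds the pair — directly when both legs carry a
step, by parts along a MOVING step otherwise (part (F3b)'s count `1 ≤ |dA| + |dB|` supplies it).
* §1 [folklore] normal form: `itL_itR_transpose`, `itL_itR_cons_right`, `eval_eq`; `exists_free_consts` (free exponent `q ≥ 2 + min k 1`, `= 7` off
  the frozen diagonal); **`leg_package`** (the five rows of a leg in part (I3a)'s format, constants `Bf`, `Dfl` uniform over pieces and entries).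
* §2 [folklore] **`exists_bound_moment_term₂`**: unit steps, `2 ≤ t.len`, `1 ≤ |t.dA| + |t.dB|`, `(r, r') ≠ (0, 0)` ⇒ ONE `Bnd ≥ 0` before `n` with —
  for every scale, every even profile `g` and `K^∞` obeying the rows, every `b, μ, ν` — summable and `|fullSum (w ↦ w_μw_ν·t.eval … (b+w) b)| ≤ Bnd`.
Unit `b2b-balaban-beta-d1-formalise-leaf-03` (gen 12), D1 formalisation swarm; `LEAVES-BFx.md` row «A3.c ∕ L-X TAILS» PART II (I3b).
-/

noncomputable section

namespace Summit.QuantumFields.BalabanUV.Beta.D1BFx.TwoPointBubbles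

open Literature.MathematicalPhysics.QuantumFieldTheory.Balaban1983to89 Literature.MathematicalPhysics.QuantumFieldTheory.Balaban1983to89.Beta
open B12Sec2to5 (l1)
open ExpKernelCalculus (Site MKer)
open DyadicShell (Pt supNorm toReal toReal_apply)
open BubbleTransfer (unitVec)
open GhostTable (gFree)
open PoissonInterior (G₀)
open TwoPowerLegs (free)
open LongitudinalWindow (ellD0 ellD1)
open WoodburyCovariant (woodburyDc woodburyD1c)
open VectorPropagatorLimit (Kinf)
open WindowIdentification (fullSum)
open GradedBubbles (iterD IsStep)
open ScaleLegTermBound (exists_soft_iterD_free)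
open TwoPointEnds (SKer itL itR itL_sub itR_diffR itL_shR itL_itR_comm itL_eq_itR_transpose)
open TwoPointFrozen (steps_append_neg)
open TwoPointLegPieces (legPiece_transpose legPiece_zero_entry_of_ne legPiece_one_entry_of_ne legPiece_two_entry_self itL_itR_zero envelope_of_soft
  far_two flat_two far_zero split_zero far_one flat_one)
open TwoPointPairs (exists_pair_bound_main exists_pair_bound_byParts)
open GradedBiBubbleTerms (ETerm₂)
open Summit.QuantumFields.BalabanUV.Beta.D1BFx.FineHessianLegGrades (legPiece)
open Summit.QuantumFields.BalabanUV.Beta.D1BFx.OffDiagonalLegGrade (ellD0_nonneg ellD1_nonneg)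

variable {n : ℕ} [NeZero n] {a : ℝ} {g : Pt → ℝ}

/-! ## §1 The normal form of a term; the leg package -/

omit [NeZero n] in
/-- [folklore] Moving the end steps of the FIRST argument to the transpose: `itL dB (itR sB P) x y = itL sB (itR dB Pᵀ) y x`. -/
theorem itL_itR_transpose (dB sB : List Pt) (P : SKer) (x y : Pt) : itL dB (itR sB P) x y = itL sB (itR dB (fun a b => P b a)) y x := by
  rw [itL_itR_comm dB sB P]
  have h2 : (fun a b => itL dB P b a) = itR dB (fun a b => P b a) := by
    funext a b; rw [itL_eq_itR_transpose dB P b a]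
  rw [← h2, itL_eq_itR_transpose sB (fun a b => itL dB P b a) y x]

omit [NeZero n] in
/-- [folklore] Extracting the first MOVING step: `itL sL (itR (e :: sR) K) x y = itL sL (itR sR K) x (y + e) − itL sL (itR sR K) x y`. -/
theorem itL_itR_cons_right (sL sR : List Pt) (e : Pt) (K : SKer) (x y : Pt) :
    itL sL (itR (e :: sR) K) x y = itL sL (itR sR K) x (y + e) - itL sL (itR sR K) x y := by
  rw [← itR_diffR sR e K, itL_sub]
  beta_reduce
  congr 1
  exact (congrFun (congrFun (itL_shR sL e (itR sR K)) x) y).symm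

/-- [folklore] **THE NORMAL FORM** of an elementary term through the pieces with the first vertex at `b + w`, the second at `b`: `c·Λ_A(w + (vA − uA))·Λ_B(w + (uB − vB))`,
`Λ_A(u) = itL sA (itR dA (legPiece r)_{a f₁}) (b+uA) (b+uA+u)`, `Λ_B(u) = itL sB (itR dB (legPiece r')_{f₂ f}) (b+vB) (b+vB+u)` (transpose law for the second leg). -/
theorem eval_eq (hn : 1 ≤ n) (ha : 0 < a) (hg : ∀ w, g (-w) = g w) (r r' : Fin 3) (t : ETerm₂ (Fin 4)) (b w : Pt) :
    t.eval (legPiece n a g r) (legPiece n a g r') (b + w) b =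
      t.c * (itL t.sA (itR t.dA (fun x y : Pt => legPiece n a g r x y t.a t.f₁)) (b + t.uA) ((b + t.uA) + (w + (t.vA - t.uA))) *
        itL t.sB (itR t.dB (fun x y : Pt => legPiece n a g r' x y t.f₂ t.f)) (b + t.vB) ((b + t.vB) + (w + (t.uB - t.vB)))) := by
  simp only [ETerm₂.eval]
  rw [itL_itR_transpose t.dB t.sB]
  have hT : (fun x y : Pt => legPiece n a g r' y x t.f t.f₂) = fun x y => legPiece n a g r' x y t.f₂ t.f := by
    funext x y; exact legPiece_transpose hn ha hg r' x y t.f₂ t.f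
  rw [hT, show b + t.uA + (w + (t.vA - t.uA)) = b + w + t.vA by abel, show b + t.vB + (w + (t.uB - t.vB)) = b + w + t.uB by abel]
  ring

omit [NeZero n] in
/-- [folklore] **FREE-PART CONSTANTS OF A LEG** (fixed before the scale): an exponent `q ≥ 2 + min k 1`, `= 7` unless the piece is the frozen one read on
a diagonal entry, and then part (C2)'s soft bound of the free leg along the combined step list at exponent `q`. -/
theorem exists_free_consts (r : Fin 3) (κ l : Fin 4) {sL sR : List Pt} (hsL : ∀ e ∈ sL, IsStep e) (hsR : ∀ e ∈ sR, IsStep e) {k : ℕ}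
    (hk : sL.length + sR.length = k) :
    ∃ (Af : ℝ) (q : ℕ), 0 ≤ Af ∧ 2 + min k 1 ≤ q ∧ (¬(r = 0 ∧ κ = l) → q = 7) ∧
      (r = 0 → κ = l → ∀ u : Pt, |iterD (sR ++ sL.map Neg.neg) free.g 0 0 u| ≤ Af / ((supNorm u : ℝ) + 1) ^ q) := by
  by_cases h : r = 0 ∧ κ = l
  · obtain ⟨hst, hlen⟩ := steps_append_neg hsL hsR
    obtain ⟨Af, hAf, hb⟩ := exists_soft_iterD_free hst
    refine ⟨Af, 2 + min (sR ++ sL.map Neg.neg).length 3, hAf, by rw [hlen]; omega, fun h' => (h' h).elim, fun _ _ u => hb 0 0 u⟩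
  · exact ⟨0, 7, le_rfl, by omega, fun _ => rfl, fun h0 hκ => (h ⟨h0, hκ⟩).elim⟩

section Package

variable {δ A₀ A₁ D₀ D₁ : ℝ}

/-- [folklore] **THE LEG PACKAGE.**  For a piece `r`, a fibre entry `(κ, l)`, unit static∕moving step lists `sL, sR` (`k` steps, `p = 2 + min k 1`), a base
point `x₀`, and free-part constants as in `exists_free_consts`: the leg `Λ(u) = itL sL (itR sR (legPiece r)_{κl}) x₀ (x₀+u)` splits `Λ = F + Φ` with
`|F| ≤ Af/(‖u‖∞+1)^q`, `|Φ| ≤ Dfl·2^k/n^p`, has the far row `Bf(1+8e^δ)^k·e^{−(δ/n)‖u‖∞}/(‖u‖∞+1)^p` and the envelope `Bf(1+8e^δ)^k·e^{−(δ/4n)‖u‖₁}`, with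
`Bf`, `Dfl` independent of `n`, of the piece, of the entry, of `x₀` and of the steps. -/
theorem leg_package {Bf Dfl : ℝ}
    (hBf : Bf = (5 * A₀ + 8 * A₁ + (|G₀ (0 : Pt)| + (woodburyDc 0 + ellD0 4 a) + ellD0 4 a)) * (8 * Real.exp δ)
      + (5 * A₀ + 8 * A₁ + (|gFree 0| + D₀)) * (8 * Real.exp δ))
    (hDfl : Dfl = ((woodburyDc 0 + ellD0 4 a) + (woodburyD1c 0 + ellD1 4 a)) + (D₀ + D₁) + (ellD0 4 a + ellD1 4 a))
    (hn : 1 ≤ n) (ha : 0 < a) (hδ : 0 ≤ δ) (hA₀ : 0 ≤ A₀) (hA₁ : 0 ≤ A₁) (hD₀ : 0 ≤ D₀) (hD₁ : 0 ≤ D₁)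
    (e0 : ∀ (x w : Pt) (κ l : Fin 4), w ≠ 0 → |Kinf n a (x, κ) (x + w, l)| ≤ A₀ * Real.exp (-(δ / n) * supNorm w) / (supNorm w : ℝ) ^ 2)
    (e1 : ∀ (x w : Pt) (κ l : Fin 4), w ≠ 0 → ∀ ρ : Fin 4,
      |Kinf n a (x, κ) (x + w + unitVec ρ, l) - Kinf n a (x, κ) (x + w, l)| ≤ A₁ * Real.exp (-(δ / n) * supNorm w) / (supNorm w : ℝ) ^ 3)
    (d0 : ∀ v : Pt, v ≠ 0 → |g v| ≤ A₀ * Real.exp (-(δ / n) * supNorm v) / (supNorm v : ℝ) ^ 2)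
    (d1 : ∀ v : Pt, v ≠ 0 → ∀ ρ : Fin 4, |g (v + unitVec ρ) - g v| ≤ A₁ * Real.exp (-(δ / n) * supNorm v) / (supNorm v : ℝ) ^ 3)
    (h0 : ∀ v : Pt, |g v - gFree v| ≤ D₀ / (n : ℝ) ^ 2)
    (h1 : ∀ (v : Pt) (ρ : Fin 4), |(g (v + unitVec ρ) - gFree (v + unitVec ρ)) - (g v - gFree v)| ≤ D₁ / (n : ℝ) ^ 3)
    (r : Fin 3) (κ l : Fin 4) {sL sR : List Pt} (hsL : ∀ e ∈ sL, IsStep e) (hsR : ∀ e ∈ sR, IsStep e) (x₀ : Pt) {k p : ℕ}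
    (hk : sL.length + sR.length = k) (hp : 2 + min k 1 = p) {Af : ℝ} {q : ℕ} (hAf : 0 ≤ Af)
    (hfree : r = 0 → κ = l → ∀ u : Pt, |iterD (sR ++ sL.map Neg.neg) free.g 0 0 u| ≤ Af / ((supNorm u : ℝ) + 1) ^ q) :
    ∃ F Φ : Pt → ℝ,
      (∀ u : Pt, itL sL (itR sR (fun x y : Pt => legPiece n a g r x y κ l)) x₀ (x₀ + u) = F u + Φ u) ∧
      (∀ u : Pt, |F u| ≤ Af / ((supNorm u : ℝ) + 1) ^ q) ∧
      (∀ u : Pt, |Φ u| ≤ Dfl * 2 ^ k / (n : ℝ) ^ p) ∧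
      (∀ u : Pt, |itL sL (itR sR (fun x y : Pt => legPiece n a g r x y κ l)) x₀ (x₀ + u)| ≤
        Bf * (1 + 2 ^ 3 * Real.exp δ) ^ k * Real.exp (-(δ / n) * supNorm u) / ((supNorm u : ℝ) + 1) ^ p) ∧
      (∀ u : Pt, |itL sL (itR sR (fun x y : Pt => legPiece n a g r x y κ l)) x₀ (x₀ + u)| ≤
        Bf * (1 + 2 ^ 3 * Real.exp δ) ^ k * Real.exp (-(δ / n / 4) * l1 u)) := by
  subst hk hp
  have hn0 : (0 : ℝ) < n := by exact_mod_cast hn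
  have hE0 := ellD0_nonneg (d := 4) ha
  have hE1 := ellD1_nonneg (d := 4) ha
  have hW0 : 0 ≤ woodburyDc 0 := VectorLegVolumeAdapter.woodburyDc_zero_nonneg
  have hW1 : 0 ≤ woodburyD1c 0 := VectorLegVolumeAdapter.woodburyD1c_zero_nonneg
  have hBf0 : 0 ≤ Bf := by rw [hBf]; positivity
  have hDfl0 : 0 ≤ Dfl := by rw [hDfl]; positivity
  -- monotonicity in the constants, and the envelope from the far row
  have farMono : ∀ {H : Pt → ℝ} {C : ℝ}, C ≤ Bf → (∀ u : Pt, |H u| ≤ C * (1 + 2 ^ 3 * Real.exp δ) ^ (sL.length + sR.length) *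
      Real.exp (-(δ / n) * supNorm u) / ((supNorm u : ℝ) + 1) ^ (2 + min (sL.length + sR.length) 1)) → ∀ u : Pt, |H u| ≤
      Bf * (1 + 2 ^ 3 * Real.exp δ) ^ (sL.length + sR.length) * Real.exp (-(δ / n) * supNorm u) / ((supNorm u : ℝ) + 1) ^ (2 + min (sL.length + sR.length) 1) := by
    intro H C hC h u
    refine (h u).trans ?_
    gcongr
  have flatMono : ∀ {X D : ℝ}, D ≤ Dfl → X ≤ D * 2 ^ (sL.length + sR.length) / (n : ℝ) ^ (2 + min (sL.length + sR.length) 1) →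
      X ≤ Dfl * 2 ^ (sL.length + sR.length) / (n : ℝ) ^ (2 + min (sL.length + sR.length) 1) := by
    intro X D hD h
    refine h.trans ?_
    gcongr
  have envOf : ∀ {H : Pt → ℝ}, (∀ u : Pt, |H u| ≤ Bf * (1 + 2 ^ 3 * Real.exp δ) ^ (sL.length + sR.length) * Real.exp (-(δ / n) * supNorm u) /
      ((supNorm u : ℝ) + 1) ^ (2 + min (sL.length + sR.length) 1)) →
      ∀ u : Pt, |H u| ≤ Bf * (1 + 2 ^ 3 * Real.exp δ) ^ (sL.length + sR.length) * Real.exp (-(δ / n / 4) * l1 u) :=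
    fun h u => envelope_of_soft (by positivity) (by positivity) h u
  -- the zero kernel
  have ofZero : ∀ {P : SKer}, P = (fun _ _ => (0 : ℝ)) → ∃ F Φ : Pt → ℝ, (∀ u, itL sL (itR sR P) x₀ (x₀ + u) = F u + Φ u) ∧
      (∀ u : Pt, |F u| ≤ Af / ((supNorm u : ℝ) + 1) ^ q) ∧
      (∀ u : Pt, |Φ u| ≤ Dfl * 2 ^ (sL.length + sR.length) / (n : ℝ) ^ (2 + min (sL.length + sR.length) 1)) ∧
      (∀ u : Pt, |itL sL (itR sR P) x₀ (x₀ + u)| ≤ Bf * (1 + 2 ^ 3 * Real.exp δ) ^ (sL.length + sR.length) * Real.exp (-(δ / n) * supNorm u) /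
        ((supNorm u : ℝ) + 1) ^ (2 + min (sL.length + sR.length) 1)) ∧
      (∀ u : Pt, |itL sL (itR sR P) x₀ (x₀ + u)| ≤ Bf * (1 + 2 ^ 3 * Real.exp δ) ^ (sL.length + sR.length) * Real.exp (-(δ / n / 4) * l1 u)) := by
    intro P hz
    subst hz
    refine ⟨fun _ => 0, fun _ => 0, fun u => by rw [itL_itR_zero]; simp, fun u => by rw [abs_zero]; positivity, fun u => by rw [abs_zero]; positivity,
      fun u => by rw [itL_itR_zero, abs_zero]; positivity, fun u => by rw [itL_itR_zero, abs_zero]; positivity⟩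
  -- no free part: `F = 0`, `Φ = H`
  have noFree : ∀ {H : Pt → ℝ} {C D : ℝ}, C ≤ Bf → D ≤ Dfl →
      (∀ u : Pt, |H u| ≤ C * (1 + 2 ^ 3 * Real.exp δ) ^ (sL.length + sR.length) * Real.exp (-(δ / n) * supNorm u) /
        ((supNorm u : ℝ) + 1) ^ (2 + min (sL.length + sR.length) 1)) →
      (∀ u : Pt, |H u| ≤ D * 2 ^ (sL.length + sR.length) / (n : ℝ) ^ (2 + min (sL.length + sR.length) 1)) →
      ∃ F Φ : Pt → ℝ, (∀ u, H u = F u + Φ u) ∧ (∀ u : Pt, |F u| ≤ Af / ((supNorm u : ℝ) + 1) ^ q) ∧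
      (∀ u : Pt, |Φ u| ≤ Dfl * 2 ^ (sL.length + sR.length) / (n : ℝ) ^ (2 + min (sL.length + sR.length) 1)) ∧
      (∀ u : Pt, |H u| ≤ Bf * (1 + 2 ^ 3 * Real.exp δ) ^ (sL.length + sR.length) * Real.exp (-(δ / n) * supNorm u) /
        ((supNorm u : ℝ) + 1) ^ (2 + min (sL.length + sR.length) 1)) ∧
      (∀ u : Pt, |H u| ≤ Bf * (1 + 2 ^ 3 * Real.exp δ) ^ (sL.length + sR.length) * Real.exp (-(δ / n / 4) * l1 u)) := by
    intro H C D hC hD hfar hflat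
    exact ⟨fun _ => 0, H, fun u => by simp, fun u => by rw [abs_zero]; positivity, fun u => flatMono hD (hflat u), farMono hC hfar,
      envOf (farMono hC hfar)⟩
  have hC₂ : (5 * A₀ + 8 * A₁ + (|G₀ (0 : Pt)| + (woodburyDc 0 + ellD0 4 a) + ellD0 4 a)) * (8 * Real.exp δ) ≤ Bf := by
    rw [hBf]
    have : 0 ≤ (5 * A₀ + 8 * A₁ + (|gFree 0| + D₀)) * (8 * Real.exp δ) := by positivity
    linarith
  have hC₀ : (5 * A₀ + 8 * A₁ + (|gFree 0| + D₀)) * (8 * Real.exp δ) ≤ Bf := by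
    rw [hBf]
    have : 0 ≤ (5 * A₀ + 8 * A₁ + (|G₀ (0 : Pt)| + (woodburyDc 0 + ellD0 4 a) + ellD0 4 a)) * (8 * Real.exp δ) := by positivity
    linarith
  fin_cases r
  · -- the frozen piece
    by_cases hκ : κ = l
    · subst hκ
      have hfar := farMono hC₀ (fun u => far_zero (a := a) hn hδ hA₀ hA₁ d0 d1 h0 κ hsL hsR x₀ u)
      exact ⟨fun u => iterD (sR ++ sL.map Neg.neg) free.g 0 0 u, fun u => iterD (sR ++ sL.map Neg.neg) (fun (_ : ℕ) (_ : ℕ) => fun v => g v - gFree v) 0 0 u,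
        fun u => (split_zero (a := a) hn hD₁ h0 h1 κ hsL hsR x₀ u).1, fun u => hfree rfl rfl u,
        fun u => flatMono (by rw [hDfl]; linarith) (split_zero (a := a) hn hD₁ h0 h1 κ hsL hsR x₀ u).2, hfar, envOf hfar⟩
    · exact ofZero (legPiece_zero_entry_of_ne hκ)
  · -- diagonal minus frozen
    by_cases hκ : κ = l
    · subst hκ
      exact noFree (le_of_eq hBf.symm) (by rw [hDfl]; linarith) (fun u => far_one hn ha hδ hA₀ hA₁ e0 e1 d0 d1 h0 κ hsL hsR x₀ u)
        (fun u => flat_one hn ha hD₁ h0 h1 κ hsL hsR x₀ u)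
    · exact ofZero (legPiece_one_entry_of_ne hκ)
  · -- off-diagonal
    by_cases hκ : κ = l
    · subst hκ
      exact ofZero (legPiece_two_entry_self κ)
    · exact noFree hC₂ (by rw [hDfl]; linarith) (fun u => far_two hn ha hδ hA₀ hA₁ e0 e1 hκ hsL hsR x₀ u) (fun u => flat_two hn ha hκ hsL hsR x₀ u)

/-! ## §2 One elementary term through two pieces under the moment weight -/

/-- [folklore] **ONE ELEMENTARY TWO-POINT TERM THROUGH `legPiece r`, `legPiece r'`, `(r, r') ≠ (0, 0)`** (unit steps, `2 ≤ t.len`, `1 ≤ |t.dA| + |t.dB|`):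
ONE `Bnd ≥ 0`, fixed before the scale, with — for every `n ≥ 1`, every even profile `g` and `K^∞` obeying the rows at scale `n` (entry rows d0∕d1 of
`K^∞`; d0∕d1∕h0∕h1 of `g`), every base point `b` and every `μ, ν` — `w ↦ w_μw_ν·t.eval (legPiece r) (legPiece r') (b + w) b` summable and `|fullSum| ≤ Bnd`.
Both legs with a step: part (I3a)'s admissible pair; one leg bare: the other carries `≥ 2` steps of which one MOVES, part (I3a)'s by-parts pair. -/
theorem exists_bound_moment_term₂ (t : ETerm₂ (Fin 4)) (ht : ∀ e ∈ t.sA ++ t.dA ++ t.dB ++ t.sB, IsStep e) (h2 : 2 ≤ t.len)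
    (hmov : 1 ≤ t.dA.length + t.dB.length) (r r' : Fin 3) (hrr : ¬(r = 0 ∧ r' = 0))
    (ha : 0 < a) (hδ : 0 < δ) (hA₀ : 0 ≤ A₀) (hA₁ : 0 ≤ A₁) (hD₀ : 0 ≤ D₀) (hD₁ : 0 ≤ D₁) :
    ∃ Bnd : ℝ, 0 ≤ Bnd ∧ ∀ (n : ℕ) [NeZero n], 1 ≤ n → ∀ (g : Pt → ℝ), (∀ w, g (-w) = g w) →
      (∀ (x w : Pt) (κ l : Fin 4), w ≠ 0 → |Kinf n a (x, κ) (x + w, l)| ≤ A₀ * Real.exp (-(δ / n) * supNorm w) / (supNorm w : ℝ) ^ 2) →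
      (∀ (x w : Pt) (κ l : Fin 4), w ≠ 0 → ∀ ρ : Fin 4,
        |Kinf n a (x, κ) (x + w + unitVec ρ, l) - Kinf n a (x, κ) (x + w, l)| ≤ A₁ * Real.exp (-(δ / n) * supNorm w) / (supNorm w : ℝ) ^ 3) →
      (∀ v : Pt, v ≠ 0 → |g v| ≤ A₀ * Real.exp (-(δ / n) * supNorm v) / (supNorm v : ℝ) ^ 2) →
      (∀ v : Pt, v ≠ 0 → ∀ ρ : Fin 4, |g (v + unitVec ρ) - g v| ≤ A₁ * Real.exp (-(δ / n) * supNorm v) / (supNorm v : ℝ) ^ 3) →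
      (∀ v : Pt, |g v - gFree v| ≤ D₀ / (n : ℝ) ^ 2) →
      (∀ (v : Pt) (ρ : Fin 4), |(g (v + unitVec ρ) - gFree (v + unitVec ρ)) - (g v - gFree v)| ≤ D₁ / (n : ℝ) ^ 3) →
      ∀ (b : Pt) (μ ν : Fin 4),
        Summable (fun w : Pt => toReal w μ * toReal w ν * t.eval (legPiece n a g r) (legPiece n a g r') (b + w) b) ∧
        |fullSum (fun w : Pt => toReal w μ * toReal w ν * t.eval (legPiece n a g r) (legPiece n a g r') (b + w) b)| ≤ Bnd := by
  obtain ⟨c, κA, lA, fB, κB, uA, vA, uB, vB, sA, dA, dB, sB⟩ := t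
  simp only [ETerm₂.len] at h2
  dsimp only at ht hmov
  have hsA : ∀ e ∈ sA, IsStep e := fun e he => ht e (by simp [he])
  have hdA : ∀ e ∈ dA, IsStep e := fun e he => ht e (by simp [he])
  have hdB : ∀ e ∈ dB, IsStep e := fun e he => ht e (by simp [he])
  have hsB : ∀ e ∈ sB, IsStep e := fun e he => ht e (by simp [he])
  -- the uniform leg constants
  obtain ⟨Bf, hBf⟩ : ∃ Bf : ℝ, Bf = (5 * A₀ + 8 * A₁ + (|G₀ (0 : Pt)| + (woodburyDc 0 + ellD0 4 a) + ellD0 4 a)) * (8 * Real.exp δ)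
      + (5 * A₀ + 8 * A₁ + (|gFree 0| + D₀)) * (8 * Real.exp δ) := ⟨_, rfl⟩
  obtain ⟨Dfl, hDfl⟩ : ∃ Dfl : ℝ, Dfl = ((woodburyDc 0 + ellD0 4 a) + (woodburyD1c 0 + ellD1 4 a)) + (D₀ + D₁) + (ellD0 4 a + ellD1 4 a) := ⟨_, rfl⟩
  have hE0 := ellD0_nonneg (d := 4) ha
  have hE1 := ellD1_nonneg (d := 4) ha
  have hW0 : 0 ≤ woodburyDc 0 := VectorLegVolumeAdapter.woodburyDc_zero_nonneg
  have hW1 : 0 ≤ woodburyD1c 0 := VectorLegVolumeAdapter.woodburyD1c_zero_nonneg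
  have hBf0 : 0 ≤ Bf := by rw [hBf]; positivity
  have hDfl0 : 0 ≤ Dfl := by rw [hDfl]; positivity
  rcases Nat.eq_zero_or_pos (sA.length + dA.length) with hkA | hkA
  · -- the first leg is bare: by parts along the first moving step of the second leg
    obtain ⟨rfl, rfl⟩ : sA = [] ∧ dA = [] := ⟨List.eq_nil_of_length_eq_zero (by omega), List.eq_nil_of_length_eq_zero (by omega)⟩
    obtain ⟨e, dB', rfl⟩ : ∃ e dB', dB = e :: dB' := by
      rcases dB with _ | ⟨e, dB'⟩
      · simp at hmov
      · exact ⟨e, dB', rfl⟩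
    have he : IsStep e := hdB e (by simp)
    have hdB' : ∀ e' ∈ dB', IsStep e' := fun e' he' => hdB e' (by simp [he'])
    have hkL : 1 ≤ sB.length + dB'.length := by simp at h2; omega
    obtain ⟨AfU, qU, hAfU, hqU, hqU7, hfU⟩ := exists_free_consts r κA lA (sL := []) (sR := []) (by simp) (by simp) (k := 0) rfl
    obtain ⟨AfV, qV, hAfV, hqV, hqV7, hfV⟩ := exists_free_consts r κA lA (sL := []) (sR := [-e]) (by simp) (by simpa using he.neg) (k := 1) rfl
    obtain ⟨AfL, qL, hAfL, hqL, hqL7, hfL⟩ := exists_free_consts r' κB fB hsB hdB' (k := sB.length + dB'.length) rfl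
    have h7 : (qU = 7 ∧ qV = 7) ∨ qL = 7 := by
      by_cases hr : r = 0
      · exact Or.inr (hqL7 fun h => hrr ⟨hr, h.1⟩)
      · exact Or.inl ⟨hqU7 fun h => hr h.1, hqV7 fun h => hr h.1⟩
    obtain ⟨Bnd, hBnd, hmain⟩ := exists_pair_bound_byParts hδ (B_U := Bf * (1 + 2 ^ 3 * Real.exp δ) ^ 0) (B_V := Bf * (1 + 2 ^ 3 * Real.exp δ) ^ 1)
      (B_L := Bf * (1 + 2 ^ 3 * Real.exp δ) ^ (sB.length + dB'.length)) (A_U := AfU) (A_V := AfV) (A_L := AfL) (D_U := Dfl * 2 ^ 0)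
      (D_V := Dfl * 2 ^ 1) (D_L := Dfl * 2 ^ (sB.length + dB'.length)) (by positivity) (by positivity) (by positivity) hAfU hAfV hAfL
      (by positivity) (by positivity) (by positivity) (q_U := qU) (q_V := qV) (q_L := qL) (by omega) (by omega) (by omega) (by omega) (by omega)
      c (vA - uA) (uB - vB) he
    refine ⟨Bnd, hBnd, fun n _ hn g hg e0 e1 d0 d1 h0 h1 b μ ν => ?_⟩
    obtain ⟨FU, ΦU, spU, frU, flU, farU, envU⟩ := leg_package hBf hDfl hn ha hδ.le hA₀ hA₁ hD₀ hD₁ e0 e1 d0 d1 h0 h1 r κA lA (sL := []) (sR := [])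
      (by simp) (by simp) (b + uA) (k := 0) (p := 2) rfl (by decide) hAfU hfU
    obtain ⟨FV, ΦV, spV, frV, flV, farV, envV⟩ := leg_package hBf hDfl hn ha hδ.le hA₀ hA₁ hD₀ hD₁ e0 e1 d0 d1 h0 h1 r κA lA (sL := []) (sR := [-e])
      (by simp) (by simpa using he.neg) (b + uA) (k := 1) (p := 3) rfl (by decide) hAfV hfV
    obtain ⟨FL, ΦL, spL, frL, flL, farL, envL⟩ := leg_package hBf hDfl hn ha hδ.le hA₀ hA₁ hD₀ hD₁ e0 e1 d0 d1 h0 h1 r' κB fB hsB hdB' (b + vB)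
      (k := sB.length + dB'.length) (p := 3) rfl (by omega) hAfL hfL
    have hV : ∀ u : Pt, itL [] (itR [-e] (fun x y : Pt => legPiece n a g r x y κA lA)) (b + uA) (b + uA + u) =
        itL [] (itR [] (fun x y : Pt => legPiece n a g r x y κA lA)) (b + uA) (b + uA + (u - e)) -
          itL [] (itR [] (fun x y : Pt => legPiece n a g r x y κA lA)) (b + uA) (b + uA + u) := fun u => by
      show legPiece n a g r (b + uA) (b + uA + u + -e) κA lA - legPiece n a g r (b + uA) (b + uA + u) κA lA =
        legPiece n a g r (b + uA) (b + uA + (u - e)) κA lA - legPiece n a g r (b + uA) (b + uA + u) κA lA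
      rw [sub_eq_add_neg u e, add_assoc]
    have eS : (fun w : Pt => toReal w μ * toReal w ν *
        ETerm₂.eval (legPiece n a g r) (legPiece n a g r') (b + w) b ⟨c, κA, lA, fB, κB, uA, vA, uB, vB, [], [], e :: dB', sB⟩) =
        fun w => toReal w μ * toReal w ν * (c * ((fun u => itL [] (itR [] (fun x y : Pt => legPiece n a g r x y κA lA)) (b + uA) (b + uA + u)) (w + (vA - uA)) *
          ((fun u => itL sB (itR dB' (fun x y : Pt => legPiece n a g r' x y κB fB)) (b + vB) (b + vB + u)) (w + ((uB - vB) + e)) -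
           (fun u => itL sB (itR dB' (fun x y : Pt => legPiece n a g r' x y κB fB)) (b + vB) (b + vB + u)) (w + (uB - vB))))) := by
      funext w
      rw [eval_eq hn ha hg]
      dsimp only
      rw [itL_itR_cons_right sB dB' e _ (b + vB) (b + vB + (w + (uB - vB))), add_assoc (b + vB) (w + (uB - vB)) e, add_assoc w (uB - vB) e]
    rw [eS]
    exact hmain n hn μ ν (fun u => itL [] (itR [] (fun x y : Pt => legPiece n a g r x y κA lA)) (b + uA) (b + uA + u))
      (fun u => itL [] (itR [-e] (fun x y : Pt => legPiece n a g r x y κA lA)) (b + uA) (b + uA + u))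
      (fun u => itL sB (itR dB' (fun x y : Pt => legPiece n a g r' x y κB fB)) (b + vB) (b + vB + u))
      FU ΦU FV ΦV FL ΦL hV spU spV spL farU farV farL frU frV frL flU flV flL ⟨_, envU⟩ ⟨_, envV⟩ ⟨_, envL⟩
  · rcases Nat.eq_zero_or_pos (sB.length + dB.length) with hkB | hkB
    · -- the second leg is bare: by parts along the first moving step of the first leg
      obtain ⟨rfl, rfl⟩ : sB = [] ∧ dB = [] := ⟨List.eq_nil_of_length_eq_zero (by omega), List.eq_nil_of_length_eq_zero (by omega)⟩
      obtain ⟨e, dA', rfl⟩ : ∃ e dA', dA = e :: dA' := by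
        rcases dA with _ | ⟨e, dA'⟩
        · simp at hmov
        · exact ⟨e, dA', rfl⟩
      have he : IsStep e := hdA e (by simp)
      have hdA' : ∀ e' ∈ dA', IsStep e' := fun e' he' => hdA e' (by simp [he'])
      have hkL : 1 ≤ sA.length + dA'.length := by simp at h2; omega
      obtain ⟨AfU, qU, hAfU, hqU, hqU7, hfU⟩ := exists_free_consts r' κB fB (sL := []) (sR := []) (by simp) (by simp) (k := 0) rfl
      obtain ⟨AfV, qV, hAfV, hqV, hqV7, hfV⟩ := exists_free_consts r' κB fB (sL := []) (sR := [-e]) (by simp) (by simpa using he.neg) (k := 1) rfl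
      obtain ⟨AfL, qL, hAfL, hqL, hqL7, hfL⟩ := exists_free_consts r κA lA hsA hdA' (k := sA.length + dA'.length) rfl
      have h7 : (qU = 7 ∧ qV = 7) ∨ qL = 7 := by
        by_cases hr' : r' = 0
        · exact Or.inr (hqL7 fun h => hrr ⟨h.1, hr'⟩)
        · exact Or.inl ⟨hqU7 fun h => hr' h.1, hqV7 fun h => hr' h.1⟩
      obtain ⟨Bnd, hBnd, hmain⟩ := exists_pair_bound_byParts hδ (B_U := Bf * (1 + 2 ^ 3 * Real.exp δ) ^ 0) (B_V := Bf * (1 + 2 ^ 3 * Real.exp δ) ^ 1)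
        (B_L := Bf * (1 + 2 ^ 3 * Real.exp δ) ^ (sA.length + dA'.length)) (A_U := AfU) (A_V := AfV) (A_L := AfL) (D_U := Dfl * 2 ^ 0)
        (D_V := Dfl * 2 ^ 1) (D_L := Dfl * 2 ^ (sA.length + dA'.length)) (by positivity) (by positivity) (by positivity) hAfU hAfV hAfL
        (by positivity) (by positivity) (by positivity) (q_U := qU) (q_V := qV) (q_L := qL) (by omega) (by omega) (by omega) (by omega) (by omega)
        c (uB - vB) (vA - uA) he
      refine ⟨Bnd, hBnd, fun n _ hn g hg e0 e1 d0 d1 h0 h1 b μ ν => ?_⟩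
      obtain ⟨FU, ΦU, spU, frU, flU, farU, envU⟩ := leg_package hBf hDfl hn ha hδ.le hA₀ hA₁ hD₀ hD₁ e0 e1 d0 d1 h0 h1 r' κB fB (sL := []) (sR := [])
        (by simp) (by simp) (b + vB) (k := 0) (p := 2) rfl (by decide) hAfU hfU
      obtain ⟨FV, ΦV, spV, frV, flV, farV, envV⟩ := leg_package hBf hDfl hn ha hδ.le hA₀ hA₁ hD₀ hD₁ e0 e1 d0 d1 h0 h1 r' κB fB (sL := []) (sR := [-e])
        (by simp) (by simpa using he.neg) (b + vB) (k := 1) (p := 3) rfl (by decide) hAfV hfV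
      obtain ⟨FL, ΦL, spL, frL, flL, farL, envL⟩ := leg_package hBf hDfl hn ha hδ.le hA₀ hA₁ hD₀ hD₁ e0 e1 d0 d1 h0 h1 r κA lA hsA hdA' (b + uA)
        (k := sA.length + dA'.length) (p := 3) rfl (by omega) hAfL hfL
      have hV : ∀ u : Pt, itL [] (itR [-e] (fun x y : Pt => legPiece n a g r' x y κB fB)) (b + vB) (b + vB + u) =
          itL [] (itR [] (fun x y : Pt => legPiece n a g r' x y κB fB)) (b + vB) (b + vB + (u - e)) -
            itL [] (itR [] (fun x y : Pt => legPiece n a g r' x y κB fB)) (b + vB) (b + vB + u) := fun u => by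
        show legPiece n a g r' (b + vB) (b + vB + u + -e) κB fB - legPiece n a g r' (b + vB) (b + vB + u) κB fB =
          legPiece n a g r' (b + vB) (b + vB + (u - e)) κB fB - legPiece n a g r' (b + vB) (b + vB + u) κB fB
        rw [sub_eq_add_neg u e, add_assoc]
      have eS : (fun w : Pt => toReal w μ * toReal w ν *
          ETerm₂.eval (legPiece n a g r) (legPiece n a g r') (b + w) b ⟨c, κA, lA, fB, κB, uA, vA, uB, vB, sA, e :: dA', [], []⟩) =
          fun w => toReal w μ * toReal w ν * (c * ((fun u => itL [] (itR [] (fun x y : Pt => legPiece n a g r' x y κB fB)) (b + vB) (b + vB + u)) (w + (uB - vB)) *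
            ((fun u => itL sA (itR dA' (fun x y : Pt => legPiece n a g r x y κA lA)) (b + uA) (b + uA + u)) (w + ((vA - uA) + e)) -
             (fun u => itL sA (itR dA' (fun x y : Pt => legPiece n a g r x y κA lA)) (b + uA) (b + uA + u)) (w + (vA - uA))))) := by
        funext w
        rw [eval_eq hn ha hg]
        dsimp only
        rw [itL_itR_cons_right sA dA' e _ (b + uA) (b + uA + (w + (vA - uA))), add_assoc (b + uA) (w + (vA - uA)) e, add_assoc w (vA - uA) e]
        ring
      rw [eS]
      exact hmain n hn μ ν (fun u => itL [] (itR [] (fun x y : Pt => legPiece n a g r' x y κB fB)) (b + vB) (b + vB + u))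
        (fun u => itL [] (itR [-e] (fun x y : Pt => legPiece n a g r' x y κB fB)) (b + vB) (b + vB + u))
        (fun u => itL sA (itR dA' (fun x y : Pt => legPiece n a g r x y κA lA)) (b + uA) (b + uA + u))
        FU ΦU FV ΦV FL ΦL hV spU spV spL farU farV farL frU frV frL flU flV flL ⟨_, envU⟩ ⟨_, envV⟩ ⟨_, envL⟩
    · -- both legs carry a step: the admissible pair
      obtain ⟨AfA, qA, hAfA, hqA, hqA7, hfA⟩ := exists_free_consts r κA lA hsA hdA (k := sA.length + dA.length) rfl
      obtain ⟨AfB, qB, hAfB, hqB, hqB7, hfB⟩ := exists_free_consts r' κB fB hsB hdB (k := sB.length + dB.length) rfl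
      have h7 : qA = 7 ∨ qB = 7 := by
        by_cases hr : r = 0
        · exact Or.inr (hqB7 fun h => hrr ⟨hr, h.1⟩)
        · exact Or.inl (hqA7 fun h => hr h.1)
      obtain ⟨Bnd, hBnd, hmain⟩ := exists_pair_bound_main hδ (B₁ := Bf * (1 + 2 ^ 3 * Real.exp δ) ^ (sA.length + dA.length))
        (B₂ := Bf * (1 + 2 ^ 3 * Real.exp δ) ^ (sB.length + dB.length)) (A₁ := AfA) (A₂ := AfB) (D₁ := Dfl * 2 ^ (sA.length + dA.length))
        (D₂ := Dfl * 2 ^ (sB.length + dB.length)) (by positivity) (by positivity) hAfA hAfB (by positivity) (by positivity)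
        (q₁ := qA) (q₂ := qB) (by omega) (by omega) (by omega) c (vA - uA) (uB - vB)
      refine ⟨Bnd, hBnd, fun n _ hn g hg e0 e1 d0 d1 h0 h1 b μ ν => ?_⟩
      obtain ⟨FA, ΦA, spA, frA, flA, farA, envA⟩ := leg_package hBf hDfl hn ha hδ.le hA₀ hA₁ hD₀ hD₁ e0 e1 d0 d1 h0 h1 r κA lA hsA hdA (b + uA)
        (k := sA.length + dA.length) (p := 3) rfl (by omega) hAfA hfA
      obtain ⟨FB, ΦB, spB, frB, flB, farB, envB⟩ := leg_package hBf hDfl hn ha hδ.le hA₀ hA₁ hD₀ hD₁ e0 e1 d0 d1 h0 h1 r' κB fB hsB hdB (b + vB)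
        (k := sB.length + dB.length) (p := 3) rfl (by omega) hAfB hfB
      have eS : (fun w : Pt => toReal w μ * toReal w ν *
          ETerm₂.eval (legPiece n a g r) (legPiece n a g r') (b + w) b ⟨c, κA, lA, fB, κB, uA, vA, uB, vB, sA, dA, dB, sB⟩) =
          fun w => toReal w μ * toReal w ν * (c * ((fun u => itL sA (itR dA (fun x y : Pt => legPiece n a g r x y κA lA)) (b + uA) (b + uA + u)) (w + (vA - uA)) *
            (fun u => itL sB (itR dB (fun x y : Pt => legPiece n a g r' x y κB fB)) (b + vB) (b + vB + u)) (w + (uB - vB)))) := by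
        funext w
        rw [eval_eq hn ha hg]
      rw [eS]
      exact hmain n hn μ ν (fun u => itL sA (itR dA (fun x y : Pt => legPiece n a g r x y κA lA)) (b + uA) (b + uA + u))
        (fun u => itL sB (itR dB (fun x y : Pt => legPiece n a g r' x y κB fB)) (b + vB) (b + vB + u))
        FA ΦA FB ΦB spA spB farA farB frA frB flA flB ⟨_, envA⟩ ⟨_, envB⟩

end Package

end Summit.QuantumFields.BalabanUV.Beta.D1BFx.TwoPointBubbles

end
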